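import Summits.KontsevichZagierPeriods.KontsevichZagierPeriods.Theses.SymplecticScissors
import Literature.NumberTheory.Transcendental.AyoubPeriodSeries
import Literature.NumberTheory.Transcendental.AyoubPeriodSeriesKernel
import Literature.NumberTheory.Transcendental.AyoubPeriodSeriesPiAlgebraic
import Literature.NumberTheory.Transcendental.AyoubPeriodSeriesLocalizing
import Literature.NumberTheory.Transcendental.AyoubPeriodSeriesProofs
import Summits.KontsevichZagierPeriods.KontsevichZagierPeriods.Theorems.SymplecticScissorsTypeAGenerationStubPdzCalculus
import Summits.KontsevichZagierPeriods.KontsevichZagierPeriods.Theorems.SymplecticScissorsTypeAGenerationStubPdzMemOan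
import Summits.KontsevichZagierPeriods.KontsevichZagierPeriods.Theorems.SymplecticScissorsTypeAGenerationStubRestrCOneAux
import Summits.KontsevichZagierPeriods.KontsevichZagierPeriods.Theorems.SymplecticScissorsTypeAGenerationStubRestrCZero
import Summits.KontsevichZagierPeriods.KontsevichZagierPeriods.Theorems.SymplecticScissorsTypeAGenerationStubRoomStepCongruence
import Summits.KontsevichZagierPeriods.KontsevichZagierPeriods.Theorems.SymplecticScissorsTypeAGenerationStubRoomLemmaIter

/-!
# `TypeAGeneration` (stmt-KontsevichZagierPeriods-18392), line `Sketch`, stub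
`stub_normalForms_of` (N1): de Rham normal forms inside type (a)

Registered stub `stub_normalForms_of` of the crux `TypeAGeneration` (Ayoub 2015 Conj. 1.1 =
Fresán 2024 Conj. 3.5; route SymplecticScissors, line `Sketch` = card stokes-compiler), Layer 1
(one-variable rational integrands), on top of
`Literature/NumberTheory/Transcendental/AyoubPeriodSeries.lean` (`AyoubRel.Oan σ = 𝒪_{k-alg}(𝔻̄^∞)`,
`AyoubRel.relAC i G = ∂G/∂zᵢ − G|_{zᵢ=1} + G|_{zᵢ=0}`, `AyoubRel.kSpan`) and of the landed line files
`…StubPdzCalculus` (Leibniz rule, `∂ᵢ zᵢ = 1`, `∂ᵢ c = 0`), `…StubPdzMemOan` (`D (Gⁿ) = n Gⁿ⁻¹ D G`),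
`…StubRestrCOneAux` (the face `zᵢ = 1` is multiplicative on `ℓ¹`), `…StubRestrCZero` (the face
`zᵢ = 0` is a ring endomorphism), `…StubRoomStepCongruence` (`zₗ ∈ 𝒪`), `…StubRoomLemmaIter`
(rational scalars).

The NORMAL-FORM step of Layer 1 (the de Rham normal form of `(ℙ¹ ∖ {α, ∞}, {0, 1})` inside
type (a)), GIVEN the germ package G1–G3 of the binomial germ `(1 − zᵢ/α)^a` (membership in `𝒪`,
formal calculus, faces), carried verbatim as the three hypotheses:

* (i) monomials reduce to their integral: `zᵢⁿ − 1/(n+1) = relAC i (zᵢⁿ⁺¹/(n+1))`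
  (`n1_monomial_normalForm`);
* (ii) poles of order `≥ 2` reduce to algebraic constants: with the pole germ
  `p = 1/(zᵢ − α) = (−α⁻¹)(1 − zᵢ/α)⁻¹` one has `∂ᵢ p = −p²`, hence for `G = −p^t/t`:
  `∂ᵢ G = p^{t+1}`, `G|_{zᵢ=1} = C κ₁`, `G|_{zᵢ=0} = C κ₀` with `κ₁, κ₀ ∈ ℚ̄`, so
  `p^{t+1} − C(κ₁ − κ₀) = relAC i G` (`n1_pole_normalForm_of`, stated for an abstract germ `B`
  with `∂ᵢ B = α⁻¹ B²`, `B|_{zᵢ=1} = C w`, `B|_{zᵢ=0} = 1`).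

Elementary (folklore); no definition is introduced. Helper names carry the prefix `n1_`.
-/

noncomputable section

-- `Summit.KontsevichZagierPeriods.KontsevichZagierPeriods.…` is the tree's mandated layout (single-conjunct summit).
set_option linter.dupNamespace false

namespace Summit.KontsevichZagierPeriods.KontsevichZagierPeriods.TypeAGenerationLine

open Finsupp MvPowerSeries
open Literature.NumberTheory.Transcendental
open Literature.NumberTheory.Transcendental.AyoubRel

/-- The binomial germ `(1 − zᵢ/α)^a ∈ ℂ[[z]]`. -/
local notation3 "binGerm[" i ", " α ", " a "]" =>
  (MvPowerSeries.rename (⇑(axisEmb i))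
    (PowerSeries.rescale (-(α : ℂ)⁻¹) (PowerSeries.binomialSeries ℂ (a : ℂ)) : MvPowerSeries Unit ℂ) :
    CSeries)

set_option quotPrecheck false in
/-- The `ℚ`-span of the type-(a) elements of `𝒪_{ℚ-alg}(𝔻̄^∞)`. -/
local notation "𝕊" =>
  kSpan (algebraMap ℚ ℂ) {x : CSeries | ∃ G ∈ Oan (algebraMap ℚ ℂ), ∃ n : ℕ, x = relAC n G}

/-! ## Helpers: powers in `𝒪`, faces and derivative of powers -/

/-- `𝒪_{k-alg}(𝔻̄^∞)` is closed under powers. [folklore] -/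
theorem n1_pow_mem_Oan {k : Type} [Field k] (σ : k →+* ℂ) {F : CSeries} (hF : F ∈ Oan σ)
    (n : ℕ) : F ^ n ∈ Oan σ := by
  induction n with
  | zero =>
    rw [pow_zero]
    exact one_mem_Oan σ
  | succ n ih =>
    rw [pow_succ]
    exact mul_mem_Oan σ ih hF

/-- `1|_{zᵢ=0} = 1`. [folklore] -/
theorem n1_restrC_zero_one (i : ℕ) : restrC i 0 (1 : CSeries) = 1 := by
  have h := s8_restrC_zero_C i 1
  rwa [map_one] at h

/-- `(Fⁿ)|_{zᵢ=0} = (F|_{zᵢ=0})ⁿ` on all of `ℂ[[z]]`. [folklore] -/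
theorem n1_restrC_zero_pow (i : ℕ) (F : CSeries) (n : ℕ) :
    restrC i 0 (F ^ n) = restrC i 0 F ^ n := by
  induction n with
  | zero => rw [pow_zero, pow_zero, n1_restrC_zero_one]
  | succ n ih => rw [pow_succ, pow_succ, s8_restrC_zero_mul, ih]

/-- `∂ᵢ 1 = 0`. [folklore] -/
theorem n1_pdz_one (i : ℕ) : pdz i (1 : CSeries) = 0 := by
  have h := w1_pdz_C i 1
  rwa [map_one] at h

/-- `∂ᵢ (Fⁿ⁺¹) = (n + 1) Fⁿ ∂ᵢ F`. [folklore] -/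
theorem n1_pdz_pow_succ (i : ℕ) (F : CSeries) (n : ℕ) :
    pdz i (F ^ (n + 1)) = C ((n : ℂ) + 1) * F ^ n * pdz i F := by
  rw [w2_map_pow (w1_pdz_mul i) (n1_pdz_one i) F (n + 1), Nat.add_sub_cancel,
    ← map_natCast (C : ℂ →+* CSeries), Nat.cast_succ]

/-- A type-(a) element `relAC i G = ∂ᵢ G − G|_{zᵢ=1} + G|_{zᵢ=0}` with `G ∈ 𝒪_{ℚ-alg}(𝔻̄^∞)` lies
in the `ℚ`-span of type (a). [folklore] -/
theorem n1_relAC_mem_span {G : CSeries} (hG : G ∈ Oan (algebraMap ℚ ℂ)) (i : ℕ) :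
    pdz i G - restrC i 1 G + restrC i 0 G ∈ 𝕊 :=
  subset_kSpan _ _ ⟨G, hG, i, rfl⟩

/-! ## (i) Monomials reduce to their integral -/

/-- **Normal form of a monomial**: `zᵢⁿ − 1/(n+1) = relAC i (zᵢⁿ⁺¹/(n+1)) ∈ ⟨a⟩_ℚ`
(`∂ᵢ (zᵢⁿ⁺¹/(n+1)) = zᵢⁿ`, `(zᵢⁿ⁺¹/(n+1))|_{zᵢ=1} = 1/(n+1)`, `(zᵢⁿ⁺¹/(n+1))|_{zᵢ=0} = 0`).
[folklore] -/
theorem n1_monomial_normalForm (i n : ℕ) : (X i : CSeries) ^ n - C (((n : ℂ) + 1)⁻¹) ∈ 𝕊 := by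
  have hn0 : ((n : ℂ) + 1) ≠ 0 := Nat.cast_add_one_ne_zero n
  have hqc : (((n + 1 : ℚ)⁻¹ : ℚ) : ℂ) = ((n : ℂ) + 1)⁻¹ := by push_cast; rfl
  have hX : (X i : CSeries) ∈ Oan (algebraMap ℚ ℂ) := s2_X_mem_Oan _ i
  have hXs : Summable fun a : ℕ →₀ ℕ => ‖coeff a (X i : CSeries)‖ :=
    summable_norm_coeff_of_mem_Oan _ hX
  have hGmem : (((n + 1 : ℚ)⁻¹ : ℚ) : ℂ) • (X i : CSeries) ^ (n + 1) ∈ Oan (algebraMap ℚ ℂ) :=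
    s6_ratCast_smul_mem_Oan _ _ (n1_pow_mem_Oan _ hX (n + 1))
  have h1 : pdz i ((((n + 1 : ℚ)⁻¹ : ℚ) : ℂ) • (X i : CSeries) ^ (n + 1)) = (X i : CSeries) ^ n := by
    rw [pdz_smul, n1_pdz_pow_succ, w1_pdz_X, if_pos rfl, mul_one, smul_eq_C_mul, ← mul_assoc,
      ← map_mul, hqc, inv_mul_cancel₀ hn0, map_one, one_mul]
  have h2 : restrC i 1 ((((n + 1 : ℚ)⁻¹ : ℚ) : ℂ) • (X i : CSeries) ^ (n + 1)) =
      C (((n : ℂ) + 1)⁻¹) := by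
    rw [restrC_smul, s4_restrC_pow hXs, s4_restrC_X, if_pos rfl, one_pow, smul_eq_C_mul, mul_one,
      hqc]
  have h3 : restrC i 0 ((((n + 1 : ℚ)⁻¹ : ℚ) : ℂ) • (X i : CSeries) ^ (n + 1)) = 0 := by
    rw [restrC_smul, pow_succ, s8_restrC_zero_mul, s8_restrC_zero_X_self, mul_zero, smul_zero]
  have h := n1_relAC_mem_span hGmem i
  rwa [h1, h2, h3, add_zero] at h

/-! ## (ii) Higher-order poles reduce to algebraic constants -/

/-- **Normal form of a higher-order pole**, abstract form. Let `B ∈ 𝒪_{ℚ-alg}(𝔻̄^∞)` with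
`∂ᵢ B = α⁻¹ B²`, `B|_{zᵢ=1} = C w`, `B|_{zᵢ=0} = 1`, `α, w ∈ ℚ̄` (the germ `B = (1 − zᵢ/α)⁻¹`,
`w = (1 − α⁻¹)⁻¹`), and `p = (−α⁻¹) B` (`= 1/(zᵢ − α)`). Then `∂ᵢ p = −p²`, so for
`G = −p^{s+1}/(s+1) ∈ 𝒪`: `∂ᵢ G = p^{s+2}`, `G|_{zᵢ=1} = C κ₁`, `G|_{zᵢ=0} = C κ₀` with
`κ₁ = −((−α⁻¹) w)^{s+1}/(s+1)`, `κ₀ = −(−α⁻¹)^{s+1}/(s+1)` algebraic, and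
`p^{s+2} − C(κ₁ − κ₀) = relAC i G ∈ ⟨a⟩_ℚ`. [folklore] -/
theorem n1_pole_normalForm_of {i : ℕ} {α w : ℂ} {B : CSeries} (hα : IsAlgebraic ℚ α)
    (hw : IsAlgebraic ℚ w) (hmem : B ∈ Oan (algebraMap ℚ ℂ))
    (hpdzB : pdz i B = α⁻¹ • (B * B)) (hr1B : restrC i 1 B = C w) (hr0B : restrC i 0 B = 1)
    (s : ℕ) :
    ∃ κ : ℂ, IsAlgebraic ℚ κ ∧ ((-α⁻¹) • B) ^ (s + 1 + 1) - C κ ∈ 𝕊 := by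
  have hs0 : ((s : ℂ) + 1) ≠ 0 := Nat.cast_add_one_ne_zero s
  -- the rational scalar `-1/(s+1)`
  have hqc : (((-(s + 1 : ℚ)⁻¹ : ℚ)) : ℂ) * ((s : ℂ) + 1) = -1 := by
    push_cast
    rw [neg_mul, inv_mul_cancel₀ hs0]
  have hqa : IsAlgebraic ℚ (((-(s + 1 : ℚ)⁻¹ : ℚ)) : ℂ) := isAlgebraic_rat ℚ _
  have hαi : IsAlgebraic ℚ (-α⁻¹) := hα.inv.neg
  -- the pole germ `p = (−α⁻¹) B ∈ 𝒪`, in `ℓ¹`, with `∂ᵢ p = −p²`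
  have hpmem : (-α⁻¹) • B ∈ Oan (algebraMap ℚ ℂ) := by
    obtain ⟨P, hP, hPα⟩ := hαi
    exact smul_mem_Oan _ ⟨P, hP, hPα⟩ hmem
  have hps : Summable fun a : ℕ →₀ ℕ => ‖coeff a ((-α⁻¹) • B)‖ :=
    summable_norm_coeff_of_mem_Oan _ hpmem
  have hdp : pdz i ((-α⁻¹) • B) = -(((-α⁻¹) • B) * ((-α⁻¹) • B)) := by
    rw [pdz_smul, hpdzB]
    simp only [smul_eq_C_mul, map_neg]
    ring
  -- `G = (-1/(s+1)) p^{s+1}`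
  have hGmem : (((-(s + 1 : ℚ)⁻¹ : ℚ)) : ℂ) • ((-α⁻¹) • B) ^ (s + 1) ∈ Oan (algebraMap ℚ ℂ) :=
    s6_ratCast_smul_mem_Oan _ _ (n1_pow_mem_Oan _ hpmem (s + 1))
  have h1 : pdz i ((((-(s + 1 : ℚ)⁻¹ : ℚ)) : ℂ) • ((-α⁻¹) • B) ^ (s + 1)) =
      ((-α⁻¹) • B) ^ (s + 1 + 1) := by
    rw [pdz_smul, n1_pdz_pow_succ, hdp, smul_eq_C_mul]
    calc C (((-(s + 1 : ℚ)⁻¹ : ℚ)) : ℂ) *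
          (C ((s : ℂ) + 1) * ((-α⁻¹) • B) ^ s * -(((-α⁻¹) • B) * ((-α⁻¹) • B)))
        = -(C ((((-(s + 1 : ℚ)⁻¹ : ℚ)) : ℂ) * ((s : ℂ) + 1))) *
            (((-α⁻¹) • B) ^ s * ((-α⁻¹) • B) * ((-α⁻¹) • B)) := by
          rw [map_mul]
          ring
      _ = ((-α⁻¹) • B) ^ (s + 1 + 1) := by
          rw [hqc, map_neg, map_one, neg_neg, one_mul, pow_succ, pow_succ]
  have h2 : restrC i 1 ((((-(s + 1 : ℚ)⁻¹ : ℚ)) : ℂ) • ((-α⁻¹) • B) ^ (s + 1)) =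
      C ((((-(s + 1 : ℚ)⁻¹ : ℚ)) : ℂ) * ((-α⁻¹) * w) ^ (s + 1)) := by
    rw [restrC_smul, s4_restrC_pow hps, restrC_smul, hr1B]
    simp only [smul_eq_C_mul]
    rw [map_mul, map_pow, map_mul]
  have h3 : restrC i 0 ((((-(s + 1 : ℚ)⁻¹ : ℚ)) : ℂ) • ((-α⁻¹) • B) ^ (s + 1)) =
      C ((((-(s + 1 : ℚ)⁻¹ : ℚ)) : ℂ) * (-α⁻¹) ^ (s + 1)) := by
    rw [restrC_smul, n1_restrC_zero_pow, restrC_smul, hr0B]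
    simp only [smul_eq_C_mul, mul_one]
    rw [map_mul, map_pow]
  refine ⟨(((-(s + 1 : ℚ)⁻¹ : ℚ)) : ℂ) * ((-α⁻¹) * w) ^ (s + 1) -
      (((-(s + 1 : ℚ)⁻¹ : ℚ)) : ℂ) * (-α⁻¹) ^ (s + 1),
    (hqa.mul ((hαi.mul hw).pow _)).sub (hqa.mul (hαi.pow _)), ?_⟩
  have h := n1_relAC_mem_span hGmem i
  rwa [h1, h2, h3, sub_add, ← map_sub] at h

/-! ## Registered form -/

/-- **N1 — normal forms inside type (a)** (de Rham normal form of `(ℙ¹ ∖ {α, ∞}, {0,1})`):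
(i) monomials reduce to their integral, `zᵢⁿ − 1/(n+1) = relAC i (zᵢⁿ⁺¹/(n+1))`;
(ii) higher-order poles reduce to algebraic constants,
`(zᵢ − α)^{−(t+1)} − κ = relAC i (−(zᵢ − α)^{−t}/t)`, `κ = ((−α)^{−t} − (1−α)^{−t})/t`, GIVEN the
germ package G1–G3 (membership, `∂ᵢ` and faces of `(1 − zᵢ/α)^a`): from G2,
`∂ᵢ (1 − zᵢ/α)⁻¹ = α⁻¹ (1 − zᵢ/α)⁻²  = α⁻¹ ((1 − zᵢ/α)⁻¹)²` (exponent law) and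
`(1 − zᵢ/α)⁻¹|_{zᵢ=0} = 1`; from G3, `(1 − zᵢ/α)⁻¹|_{zᵢ=1} = (1 − α⁻¹)^{−1} = (1 − α⁻¹)⁻¹ ∈ ℚ̄`;
from G1 (exponent `q = −1`), `(1 − zᵢ/α)⁻¹ ∈ 𝒪_{ℚ-alg}(𝔻̄^∞)`. [folklore] -/
theorem stub_normalForms_of :
    (∀ (i : ℕ) (α : ℂ), IsAlgebraic ℚ α → 1 < ‖α‖ → ∀ (q : ℚ),
      binGerm[i, α, (q : ℂ)] ∈ Oan (algebraMap ℚ ℂ) ∧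
      (∀ l : ℕ, UsesVar (binGerm[i, α, (q : ℂ)]) l → l = i) ∧
      (∀ ρ : ℕ → ℝ, (∀ l, 0 ≤ ρ l) → ρ i < ‖α‖ →
        Summable fun a : ℕ →₀ ℕ =>
          ‖MvPowerSeries.coeff a (binGerm[i, α, (q : ℂ)])‖ * a.prod fun l n => ρ l ^ n) ∧
      (|q| ≤ 1 → ∀ n : ℕ, 1 ≤ n → ‖Ring.choose (q : ℂ) n‖ ≤ |(q : ℝ)|)) →
    (∀ (i : ℕ) (α : ℂ),
      (∀ (a : ℂ) (n : ℕ), MvPowerSeries.coeff (Finsupp.single i n) (binGerm[i, α, a]) =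
        Ring.choose a n * (-α⁻¹) ^ n) ∧
      (∀ (a : ℂ) (x : ℕ →₀ ℕ), (∀ n : ℕ, x ≠ Finsupp.single i n) →
        MvPowerSeries.coeff x (binGerm[i, α, a]) = 0) ∧
      (∀ a b : ℂ, binGerm[i, α, a + b] = binGerm[i, α, a] * binGerm[i, α, b]) ∧
      binGerm[i, α, (0 : ℂ)] = 1 ∧
      binGerm[i, α, (1 : ℂ)] = 1 - C α⁻¹ * X i ∧
      (∀ a : ℂ, pdz i (binGerm[i, α, a]) = (-(a * α⁻¹)) • binGerm[i, α, a - 1]) ∧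
      (∀ a : ℂ, restrC i 0 (binGerm[i, α, a]) = 1)) →
    (∀ (i : ℕ) (α : ℂ), 1 < ‖α‖ →
      (∀ a : ℂ, restrC i 1 (binGerm[i, α, a]) = C ((1 - α⁻¹) ^ a)) ∧
      intC ((-α⁻¹) • binGerm[i, α, (-1 : ℂ)]) = Complex.log (1 - α⁻¹)) →
    (∀ (i n : ℕ), (X i : CSeries) ^ n - C (((n : ℂ) + 1)⁻¹) ∈ 𝕊) ∧
    (∀ (i : ℕ) (α : ℂ), IsAlgebraic ℚ α → 1 < ‖α‖ → ∀ t : ℕ, 1 ≤ t →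
      ∃ κ : ℂ, IsAlgebraic ℚ κ ∧ ((-α⁻¹) • binGerm[i, α, (-1 : ℂ)]) ^ (t + 1) - C κ ∈ 𝕊) := by
  intro hG1 hG2 hG3
  refine ⟨n1_monomial_normalForm, fun i α hα h1 t ht => ?_⟩
  obtain ⟨s, rfl⟩ : ∃ s, t = s + 1 := ⟨t - 1, by omega⟩
  obtain ⟨-, -, hadd, -, -, hpdz, hr0⟩ := hG2 i α
  obtain ⟨hr1, -⟩ := hG3 i α h1
  -- G1 at the rational exponent `q = -1`
  have hmem : binGerm[i, α, (-1 : ℂ)] ∈ Oan (algebraMap ℚ ℂ) := by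
    have h := (hG1 i α hα h1 (-1)).1
    rwa [Rat.cast_neg, Rat.cast_one] at h
  -- G2: `∂ᵢ B = α⁻¹ B²` for `B = (1 − zᵢ/α)⁻¹` (derivative rule at `a = -1`, exponent law)
  have hpdzB : pdz i binGerm[i, α, (-1 : ℂ)] =
      α⁻¹ • (binGerm[i, α, (-1 : ℂ)] * binGerm[i, α, (-1 : ℂ)]) := by
    rw [hpdz, sub_eq_add_neg, hadd, neg_mul, one_mul, neg_neg]
  -- G3: the face value `(1 − α⁻¹)^{-1} = (1 − α⁻¹)⁻¹` is algebraic
  have hw : IsAlgebraic ℚ ((1 - α⁻¹) ^ (-1 : ℂ)) := by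
    rw [Complex.cpow_neg_one]
    exact (isAlgebraic_one.sub hα.inv).inv
  exact n1_pole_normalForm_of hα hw hmem hpdzB (hr1 (-1)) (hr0 (-1)) s

end Summit.KontsevichZagierPeriods.KontsevichZagierPeriods.TypeAGenerationLine
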